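import Mathlib
import HarnessLib
import Literature.AlgebraicGeometry.Ramification.InertiaNormalSylow
import Literature.AlgebraicGeometry.Ramification.NormalSylowExtensions
import Literature.AlgebraicGeometry.Resolution.Blowups
import Summits.ResolutionOfSingularities.ResolutionOfSingularities.Theorems.WildQuotientsWildQuotientResolutionStubInertiaLe
import Summits.ResolutionOfSingularities.ResolutionOfSingularities.Theorems.WildQuotientsWildQuotientResolutionCentreBlowupInertia

/-!
# Round bookkeeping for CURVE moves on a regular threefold: the non-p-closed locus stays finite and made of closed points (crux `WildQuotients.WildQuotientResolution`)

Crux stmt-ResolutionOfSingularities-15640 (`WildQuotientResolution`), registered stub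
`stub_phaseZeroHighDim`, move-game track (`…CurveStep` p810571, `…CentreBlowupInertia` p810283).
Companion of ✓`PointMoveNpcClosedPersist` / ✓`PointMoveNpcFinitePersist` for the other move of the
terminating design (memo `PHASE0-DIM3-TERMINATION.md` §3, addendum v2 (R8)): for the equivariant
blow-up `π : X♯ → X′` of a stable ideal sheaf `𝒥` whose subscheme is a REGULAR CURVE on a
regular threefold (hypotheses of ✓`hasNormalSylow_inertia_of_regularCentreBlowup_three`, pointwise
over the support), NO point over the support is non-p-closed; off the support `π` is an
isomorphism (`IsBlowup.isIso_compl`), injective, and inertia only shrinks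
(✓`InertiaLe.stub_inertia_le`). Hence `NPC(X♯)` injects into `NPC(X′) ∖ V(𝒥)`: finiteness and
«all non-p-closed points are closed» persist under curve moves.

* `injOn_base_off_support` — a blow-up is injective off the preimage of the support of its centre.
* `isClosed_singleton_of_injOn_preimage` — topology: closed image in a set over which the map is
  injective ⇒ closed point.
* `not_mem_support_of_not_hasNormalSylow_curveMove`, `finite_npc_of_curveMove`,
  `isClosed_singleton_of_not_hasNormalSylow_inertia_of_curveMove` — the bookkeeping.

[OURS · crux stmt-ResolutionOfSingularities-15640 · helper toward `stub_phaseZeroHighDim`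
(threefold Phase 0, round bookkeeping); folklore, counted 0; AI-level work, weaker than expert
review.]
-/

-- single-problem summit: the doubled namespace component `ResolutionOfSingularities` is forced
set_option linter.dupNamespace false

namespace Summit.ResolutionOfSingularities.ResolutionOfSingularities.Theorems.WildQuotientResolution.PointMoveNoNpcCurves

open CategoryTheory AlgebraicGeometry TopologicalSpace IsLocalRing
open Literature.AlgebraicGeometry.Resolution Literature.AlgebraicGeometry.Ramification
open Summit.ResolutionOfSingularities.ResolutionOfSingularities.Theorems.WildQuotientResolution.CentreBlowupInertia

/-- **A blow-up is injective off the preimage of the support of its centre** (it is an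
isomorphism there, `IsBlowup.isIso_compl`). [folklore; StacksProject 02OS] -/
theorem injOn_base_off_support {X' Xs : Scheme.{0}} (I : X'.IdealSheafData) {π : Xs ⟶ X'}
    (hπ : IsBlowup π I) : Set.InjOn π.base {x : Xs | π.base x ∉ (I.support : Set X')} := by
  set W₀ : X'.Opens := ⟨(I.support : Set X')ᶜ, I.support.isClosed.isOpen_compl⟩ with hW₀
  haveI : IsIso (π ∣_ W₀) := hπ.isIso_compl
  have hmemW : ∀ y : Xs, y ∈ π ⁻¹ᵁ W₀ ↔ π.base y ∉ (I.support : Set X') := fun y => Iff.rfl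
  have hinj : Function.Injective (π ∣_ W₀).base :=
    (TopCat.homeoOfIso (asIso (π ∣_ W₀).base)).injective
  intro x hx x' hx' hxx'
  have heq : (⟨x, (hmemW x).mpr hx⟩ : π ⁻¹ᵁ W₀) = ⟨x', (hmemW x').mpr hx'⟩ := by
    apply hinj
    apply Subtype.ext
    rw [morphismRestrict_base_coe, morphismRestrict_base_coe]
    exact hxx'
  exact congrArg Subtype.val heq

/-- **Topology: a point with closed image inside a set over which the map is injective is
closed.** If `f : X → Y` is continuous, `{f x}` is closed, `f x ∈ U` and `f` is injective on
`f⁻¹ U`, then `{x}` is closed: a specialisation `x ⤳ x′` gives `f x ⤳ f x′`, so `f x′ = f x ∈ U` and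
`x′ = x`. [folklore] -/
theorem isClosed_singleton_of_injOn_preimage {X Y : Type*} [TopologicalSpace X]
    [TopologicalSpace Y] {f : X → Y} (hf : Continuous f) (U : Set Y)
    (hinj : Set.InjOn f (f ⁻¹' U)) {x : X} (hxU : f x ∈ U) (hcl : IsClosed ({f x} : Set Y)) :
    IsClosed ({x} : Set X) := by
  rw [← closure_subset_iff_isClosed]
  intro x' hx'
  have hspec : x ⤳ x' := specializes_iff_mem_closure.mpr hx'
  have heq : f x' = f x := by
    have : f x' ∈ closure ({f x} : Set Y) := specializes_iff_mem_closure.mp (hspec.map hf)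
    rw [hcl.closure_eq] at this
    exact this
  have hx'U : x' ∈ f ⁻¹' U := by change f x' ∈ U; rw [heq]; exact hxU
  exact (hinj hx'U hxU heq)

/-- **Over a blown-up regular stable curve on a regular threefold there are no non-p-closed
points** (✓`hasNormalSylow_inertia_of_regularCentreBlowup_three`, hypotheses pointwise over the
support): a non-p-closed point of `X♯` lies off `π⁻¹ V(𝒥)`. [folklore] -/
theorem not_mem_support_of_not_hasNormalSylow_curveMove (p : ℕ) [Fact p.Prime]
    {X' X₁ : Scheme.{0}} (q : X' ⟶ X₁) [IsAffineHom q]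
    {G : Type} [Group G] [Finite G] (ρ : G →* Aut X') (hfaith : Function.Injective ρ)
    (hρ : ∀ g : G, (ρ g).hom ≫ q = q) [IsIntegral X'] [IsLocallyNoetherian X']
    (𝒥 : X'.IdealSheafData) (h𝒥 : ∀ g : G, 𝒥.comap (ρ g).hom = 𝒥)
    (hC : Literature.AlgebraicGeometry.Resolution.Scheme.IsRegular 𝒥.subscheme)
    {Xs : Scheme.{0}} {π : Xs ⟶ X'} (hπ : IsBlowup π 𝒥) [IsIntegral Xs]
    (ρs : G →* Aut Xs) (hequiv : ∀ g : G, (ρs g).hom ≫ π = π ≫ (ρ g).hom)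
    (hcharZ : ∀ x : Xs, π.base x ∈ (𝒥.support : Set X') →
      CharP (ResidueField (X'.presheaf.stalk (π.base x))) p)
    (hcharX : ∀ x : Xs, π.base x ∈ (𝒥.support : Set X') →
      CharP (ResidueField (Xs.presheaf.stalk x)) p)
    (hregZ : ∀ x : Xs, π.base x ∈ (𝒥.support : Set X') →
      IsRegularLocalRing (X'.presheaf.stalk (π.base x)))
    (hdim3 : ∀ x : Xs, π.base x ∈ (𝒥.support : Set X') →
      ringKrullDim (X'.presheaf.stalk (π.base x)) = (3 : ℕ))
    (hdim1 : ∀ x : Xs, π.base x ∈ (𝒥.support : Set X') →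
      ringKrullDim (X'.presheaf.stalk (π.base x) ⧸ stalkIdeal 𝒥 (π.base x)) = (1 : ℕ))
    (x : Xs) (hnpc : ¬ HasNormalSylow p (inertiaSubgroup ρs x)) :
    π.base x ∉ (𝒥.support : Set X') := by
  intro hx
  haveI := hcharZ x hx
  haveI := hcharX x hx
  haveI := hregZ x hx
  exact hnpc (hasNormalSylow_inertia_of_regularCentreBlowup_three p q ρ hfaith hρ 𝒥 h𝒥 hC hπ ρs hequiv
    x hx (hdim3 x hx) (hdim1 x hx))

/-- **Finiteness of the non-p-closed locus persists under curve moves (regular threefold).**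
[folklore] -/
theorem finite_npc_of_curveMove (p : ℕ) [Fact p.Prime]
    {X' X₁ : Scheme.{0}} (q : X' ⟶ X₁) [IsAffineHom q]
    {G : Type} [Group G] [Finite G] (ρ : G →* Aut X') (hfaith : Function.Injective ρ)
    (hρ : ∀ g : G, (ρ g).hom ≫ q = q) [IsIntegral X'] [IsLocallyNoetherian X']
    (𝒥 : X'.IdealSheafData) (h𝒥 : ∀ g : G, 𝒥.comap (ρ g).hom = 𝒥)
    (hC : Literature.AlgebraicGeometry.Resolution.Scheme.IsRegular 𝒥.subscheme)
    {Xs : Scheme.{0}} {π : Xs ⟶ X'} (hπ : IsBlowup π 𝒥) [IsIntegral Xs]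
    (ρs : G →* Aut Xs) (hequiv : ∀ g : G, (ρs g).hom ≫ π = π ≫ (ρ g).hom)
    (hcharZ : ∀ x : Xs, π.base x ∈ (𝒥.support : Set X') →
      CharP (ResidueField (X'.presheaf.stalk (π.base x))) p)
    (hcharX : ∀ x : Xs, π.base x ∈ (𝒥.support : Set X') →
      CharP (ResidueField (Xs.presheaf.stalk x)) p)
    (hregZ : ∀ x : Xs, π.base x ∈ (𝒥.support : Set X') →
      IsRegularLocalRing (X'.presheaf.stalk (π.base x)))
    (hdim3 : ∀ x : Xs, π.base x ∈ (𝒥.support : Set X') →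
      ringKrullDim (X'.presheaf.stalk (π.base x)) = (3 : ℕ))
    (hdim1 : ∀ x : Xs, π.base x ∈ (𝒥.support : Set X') →
      ringKrullDim (X'.presheaf.stalk (π.base x) ⧸ stalkIdeal 𝒥 (π.base x)) = (1 : ℕ))
    (hfin : ({y : X' | ¬ HasNormalSylow p (inertiaSubgroup ρ y)}).Finite) :
    ({x : Xs | ¬ HasNormalSylow p (inertiaSubgroup ρs x)}).Finite := by
  have hoff : {x : Xs | ¬ HasNormalSylow p (inertiaSubgroup ρs x)} ⊆
      {x : Xs | π.base x ∉ (𝒥.support : Set X')} := fun x hx =>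
    not_mem_support_of_not_hasNormalSylow_curveMove p q ρ hfaith hρ 𝒥 h𝒥 hC hπ ρs hequiv hcharZ hcharX
      hregZ hdim3 hdim1 x hx
  refine Set.Finite.of_finite_image (hfin.subset ?_) ((injOn_base_off_support 𝒥 hπ).mono hoff)
  rintro _ ⟨x, hx, rfl⟩
  exact fun h => hx ((h.subgroup ((inertiaSubgroup ρs x).subgroupOf
    (inertiaSubgroup ρ (π.base x)))).of_mulEquiv
      (Subgroup.subgroupOfEquivOfLe (InertiaLe.stub_inertia_le ρs ρ π hequiv x)))

/-- **«NPC ⊆ closed points» persists under curve moves (regular threefold).** [folklore] -/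
theorem isClosed_singleton_of_not_hasNormalSylow_inertia_of_curveMove (p : ℕ) [Fact p.Prime]
    {X' X₁ : Scheme.{0}} (q : X' ⟶ X₁) [IsAffineHom q]
    {G : Type} [Group G] [Finite G] (ρ : G →* Aut X') (hfaith : Function.Injective ρ)
    (hρ : ∀ g : G, (ρ g).hom ≫ q = q) [IsIntegral X'] [IsLocallyNoetherian X']
    (𝒥 : X'.IdealSheafData) (h𝒥 : ∀ g : G, 𝒥.comap (ρ g).hom = 𝒥)
    (hC : Literature.AlgebraicGeometry.Resolution.Scheme.IsRegular 𝒥.subscheme)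
    {Xs : Scheme.{0}} {π : Xs ⟶ X'} (hπ : IsBlowup π 𝒥) [IsIntegral Xs]
    (ρs : G →* Aut Xs) (hequiv : ∀ g : G, (ρs g).hom ≫ π = π ≫ (ρ g).hom)
    (hcharZ : ∀ x : Xs, π.base x ∈ (𝒥.support : Set X') →
      CharP (ResidueField (X'.presheaf.stalk (π.base x))) p)
    (hcharX : ∀ x : Xs, π.base x ∈ (𝒥.support : Set X') →
      CharP (ResidueField (Xs.presheaf.stalk x)) p)
    (hregZ : ∀ x : Xs, π.base x ∈ (𝒥.support : Set X') →
      IsRegularLocalRing (X'.presheaf.stalk (π.base x)))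
    (hdim3 : ∀ x : Xs, π.base x ∈ (𝒥.support : Set X') →
      ringKrullDim (X'.presheaf.stalk (π.base x)) = (3 : ℕ))
    (hdim1 : ∀ x : Xs, π.base x ∈ (𝒥.support : Set X') →
      ringKrullDim (X'.presheaf.stalk (π.base x) ⧸ stalkIdeal 𝒥 (π.base x)) = (1 : ℕ))
    (hbase : ∀ y : X', ¬ HasNormalSylow p (inertiaSubgroup ρ y) → IsClosed ({y} : Set X'))
    (x : Xs) (hnpc : ¬ HasNormalSylow p (inertiaSubgroup ρs x)) :
    IsClosed ({x} : Set Xs) := by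
  have hx : π.base x ∉ (𝒥.support : Set X') :=
    not_mem_support_of_not_hasNormalSylow_curveMove p q ρ hfaith hρ 𝒥 h𝒥 hC hπ ρs hequiv hcharZ hcharX
      hregZ hdim3 hdim1 x hnpc
  have hy : ¬ HasNormalSylow p (inertiaSubgroup ρ (π.base x)) := fun h =>
    hnpc ((h.subgroup ((inertiaSubgroup ρs x).subgroupOf (inertiaSubgroup ρ (π.base x)))).of_mulEquiv
      (Subgroup.subgroupOfEquivOfLe (InertiaLe.stub_inertia_le ρs ρ π hequiv x)))
  exact isClosed_singleton_of_injOn_preimage π.continuous ((𝒥.support : Set X')ᶜ)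
    (injOn_base_off_support 𝒥 hπ) hx (hbase _ hy)

end Summit.ResolutionOfSingularities.ResolutionOfSingularities.Theorems.WildQuotientResolution.PointMoveNoNpcCurves
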